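import Literature.AlgebraicGeometry.HodgeTheory.HolomorphicBundleChernCharacterTopDegree
import Literature.AlgebraicGeometry.HodgeTheory.ChernCharacterClass
import Literature.AlgebraicGeometry.Motives.SegreEmbedding
import Literature.AlgebraicGeometry.Motives.ToProjFunctionField
import HarnessLib

/-!
# `ch₁(𝒪(-1))` is additive under the Segre embedding of two projective embeddings

Family `hodge`, layer `Literature/AlgebraicGeometry/HodgeTheory`. For a smooth projective complex variety `T`
with a Hodge model `A`, two closed immersions `Φ₁ : T ⟶ ℙ^{K₁}`, `Φ₂ : T ⟶ ℙ^{K₂}` and the composite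
`Σ = (Φ₁, Φ₂) ≫ σ : T ⟶ ℙ^{K₁K₂+K₁+K₂}` with the Segre embedding `σ` (`Motives.segreEmbedding`, coordinates
`z_{(a,b)} = x_a y_b` in the lexicographic order `Motives.segreIndexEquiv`), the first Chern character classes
(`HodgeModel.chernCharacter`) of the tautological cocycles `𝒪(-1)|_{T^an}`
(`Motives.AnalytificationKaehler.tautologicalBundle`, transition functions `Φ^*(xᵢ/xⱼ) ∘ φ`) satisfy
**`ch₁(𝒪_Σ(-1)) = ch₁(𝒪_{Φ₁}(-1)) + ch₁(𝒪_{Φ₂}(-1))` in `H²(T(ℂ); ℂ)`**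
(`HodgeModel.chernCharacter_tautologicalBundle_segre`) — `Σ^*𝒪(1) = Φ₁^*𝒪(1) ⊗ Φ₂^*𝒪(1)` (Hartshorne II
Ex. 5.11–5.12: `σ^*𝒪(1) = 𝒪(1,1)`) and `c₁(L ⊗ L') = c₁(L) + c₁(L')` (Kobayashi II (1.9)–(1.10)). Proof:

* *(scheme side, Part A)* `Σ⁻¹D₊(z_{(a,b)}) = Φ₁⁻¹D₊(x_a) ∩ Φ₂⁻¹D₊(y_b)` (`preU_lift_segre`, from
  `Segre.segre_preimage_basicOpen`) and `Σ^*(z_{(a,b)}/z_{(a',b')}) = Φ₁^*(x_a/x_{a'}) · Φ₂^*(y_b/y_{b'})` on that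
  chart (`homRatio_lift_segre`: over `D₊(x_{a'}) ×ₖ D₊(y_{b'})` the Segre map is `Spec` of
  `z_{(a,b)}/z_{(a',b')} ↦ (x_a/x_{a'})(y_b/y_{b'})`, `Segre.segreMap`, natural in the test scheme); hence the same
  identity for the values at points and for the affine coordinates on an analytification
  (`coordFun_lift_segreEmbedding`): the cocycle of `Σ` is the TENSOR PRODUCT of the cocycles of `Φ₁`, `Φ₂`;
* *(Chern–Weil, Part B)* on `𝒪_Σ(-1)` the sums `ω¹_{a'} + ω²_{b'}` of the Fubini–Study connection forms of
  `𝒪_{Φᵢ}(-1)` (`tautologicalConnection`, `ωⁱ = Gⁱ^*∂ log ‖Z‖²`) form a connection — the gauge law (Kobayashi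
  I (1.16)) of a product of transition functions is the sum of the two gauge laws, `(fg)⁻¹ d(fg) = f⁻¹ df + g⁻¹ dg`
  (`segre_form_eq`) — with curvature `Ω¹_{a'} + Ω²_{b'}` (rank one: `ω ∧ ω = 0`), so its first Chern character
  form is the SUM of the global forms `-(θᵢ/2π)` of `HodgeModel.isChernCharacterForm_tautologicalConnection`
  (Kobayashi II (2.21)); `HodgeModel.pullback_chernCharacter` (any connection computes `ch₁`, Kobayashi II
  Thm. 2.16) and the injectivity of `A.pullback` conclude.

Everything is proved; no definitions, no named facts.

## References

* R. Hartshorne, *Algebraic Geometry* (GTM 52, 1977), I Ex. 2.14, II Ex. 5.11–5.12, II Thm. 7.1. [Hartshorne1977]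
* S. Kobayashi, *Differential Geometry of Complex Vector Bundles* (1987), Ch. I §1 (1.12), (1.16); Ch. II
  §1 (1.9)–(1.10), §2 (2.21), Thm. 2.16. [Kobayashi1987]
* P. Griffiths, J. Harris, *Principles of Algebraic Geometry* (1978), Ch. 0 §5 p. 73. [GriffithsHarris1978]
-/

noncomputable section

open CategoryTheory AlgebraicGeometry Limits HomogeneousLocalization
open Literature.AlgebraicGeometry.Motives Literature.AlgebraicGeometry.Motives.Segre
open Literature.AlgebraicGeometry.Motives.GeneratingSections Literature.AlgebraicGeometry.Motives.AnalytificationKaehler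
open Literature.NumberTheory.Transcendental Literature.Geometry.Kaehler
open MvPolynomial (X)
open scoped Manifold ContDiff

universe u

namespace Literature.AlgebraicGeometry.HodgeTheory

/-! ## Part A. The charts and ratios of `(r₁, r₂) ≫ segre`: the tensor product cocycle -/

section Scheme

variable {ι κ τ : Type} {k : Type u} [CommRing k] (e : ι × κ ≃ τ) {Y : Scheme.{u}}

/- The grading `MvPolynomial.gradedAlgebra` is not a global instance: it is supplied by `letI` (as in `HyperplaneClassPullback`). -/

/-- **The charts of a map through the Segre embedding are intersections of charts**: for `r = (r₁, r₂) ≫ segre`,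
`r⁻¹D₊(z_{(a,b)}) = r₁⁻¹D₊(x_a) ∩ r₂⁻¹D₊(y_b)` (`segre⁻¹D₊(z_{(a,b)}) = D₊(x_a) ×ₖ D₊(y_b)`). [cite: Hartshorne1977, II Ex. 5.11] -/
theorem preU_lift_segre (a : ι) (b : κ) :
    letI := MvPolynomial.gradedAlgebra (σ := ι) (R := k)
    letI := MvPolynomial.gradedAlgebra (σ := κ) (R := k)
    letI := MvPolynomial.gradedAlgebra (σ := τ) (R := k)
    ∀ (r₁ : Y ⟶ Proj (grading ι k)) (r₂ : Y ⟶ Proj (grading κ k)) (H : r₁ ≫ toSpec ι k = r₂ ≫ toSpec κ k),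
      preU (pullback.lift r₁ r₂ H ≫ segre k e) (e (a, b)) = preU r₁ a ⊓ preU r₂ b := by
  intro r₁ r₂ H
  letI := MvPolynomial.gradedAlgebra (σ := ι) (R := k); letI := MvPolynomial.gradedAlgebra (σ := κ) (R := k)
  letI := MvPolynomial.gradedAlgebra (σ := τ) (R := k)
  change (pullback.lift r₁ r₂ H ≫ segre k e) ⁻¹ᵁ Proj.basicOpen (grading τ k) (X (e (a, b))) =
    r₁ ⁻¹ᵁ Proj.basicOpen (grading ι k) (X a) ⊓ r₂ ⁻¹ᵁ Proj.basicOpen (grading κ k) (X b)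
  rw [Scheme.Hom.comp_preimage, segre_preimage_basicOpen, Scheme.Hom.preimage_inf,
    ← Scheme.Hom.comp_preimage, ← Scheme.Hom.comp_preimage, pullback.lift_fst, pullback.lift_snd]

/-- **The ratios of a map through the Segre embedding are products of ratios**: for `r = (r₁, r₂) ≫ segre`,
`r^*(z_{(a,b)}/z_{(a',b')}) = r₁^*(x_a/x_{a'}) · r₂^*(y_b/y_{b'})` on `r⁻¹D₊(z_{(a',b')})`: over `D₊(x_{a'}) ×ₖ D₊(y_{b'})` the
Segre map is `Spec` of `z_{(a,b)}/z_{(a',b')} ↦ (x_a/x_{a'})(y_b/y_{b'})` (`Segre.segreMap`, natural in the test scheme), and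
the chart lift of `r` is determined by its composite with `D₊(z_{(a',b')}) → ℙ(τ)`. [cite: Hartshorne1977, II Ex. 5.11] -/
theorem homRatio_lift_segre (a a' : ι) (b b' : κ) :
    letI := MvPolynomial.gradedAlgebra (σ := ι) (R := k)
    letI := MvPolynomial.gradedAlgebra (σ := κ) (R := k)
    letI := MvPolynomial.gradedAlgebra (σ := τ) (R := k)
    ∀ (r₁ : Y ⟶ Proj (grading ι k)) (r₂ : Y ⟶ Proj (grading κ k)) (H : r₁ ≫ toSpec ι k = r₂ ≫ toSpec κ k)
      (h₁ : preU (pullback.lift r₁ r₂ H ≫ segre k e) (e (a', b')) ≤ preU r₁ a')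
      (h₂ : preU (pullback.lift r₁ r₂ H ≫ segre k e) (e (a', b')) ≤ preU r₂ b'),
      homRatio (pullback.lift r₁ r₂ H ≫ segre k e) (e (a', b')) (e (a, b)) =
        rs h₁ (homRatio r₁ a' a) * rs h₂ (homRatio r₂ b' b) := by
  intro r₁ r₂ H h₁ h₂
  letI := MvPolynomial.gradedAlgebra (σ := ι) (R := k); letI := MvPolynomial.gradedAlgebra (σ := κ) (R := k)
  letI := MvPolynomial.gradedAlgebra (σ := τ) (R := k)
  set r := pullback.lift r₁ r₂ H ≫ segre k e with hr
  set W := preU r (e (a', b')) with hW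
  -- the two chart maps `W → D₊(x_{a'})`, `W → D₊(y_{b'})`
  set α : (W : Scheme.{u}) ⟶ Spec (.of (Away (grading ι k) (X a'))) := Y.homOfLE h₁ ≫ chartLift r₁ a' with hα
  set β : (W : Scheme.{u}) ⟶ Spec (.of (Away (grading κ k) (X b'))) := Y.homOfLE h₂ ≫ chartLift r₂ b' with hβ
  have hα' : α ≫ chartι k a' = W.ι ≫ r₁ := by rw [hα, Category.assoc, chartLift_chartι, Scheme.homOfLE_ι_assoc]
  have hβ' : β ≫ chartι k b' = W.ι ≫ r₂ := by rw [hβ, Category.assoc, chartLift_chartι, Scheme.homOfLE_ι_assoc]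
  have hαβ : α ≫ chartι k a' ≫ toSpec ι k = β ≫ chartι k b' ≫ toSpec κ k := by
    rw [← Category.assoc, hα', ← Category.assoc, hβ', Category.assoc, Category.assoc, H]
  -- `W → Y → ℙ(ι) ×ₖ ℙ(κ)` factors through the chart `D₊(x_{a'}) ×ₖ D₊(y_{b'})` of the product cover
  have hfac : W.ι ≫ pullback.lift r₁ r₂ H = pullback.lift α β hαβ ≫ (prodCover ι κ k).f (a', b') := by
    apply pullback.hom_ext
    · rw [Category.assoc, pullback.lift_fst, Category.assoc, prodCover_f_fst, chartFst, pullback.lift_fst_assoc, hα']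
    · rw [Category.assoc, pullback.lift_snd, Category.assoc, prodCover_f_snd, chartSnd, pullback.lift_snd_assoc, hβ']
  -- hence on `W` the map `r` is the chart-level Segre map of `(α, β)`, which determines the chart lift
  have hWr : W.ι ≫ r = segreMap e a' b' α β := by
    rw [hr, ← Category.assoc, hfac, Category.assoc, prodCover_f_segre, segreChart, comp_segreMap,
      chartFst, chartSnd, pullback.lift_fst, pullback.lift_snd]
  have hlift : chartLift r (e (a', b')) = (W : Scheme.{u}).toSpecΓ ≫ Spec.map (CommRingCat.ofHom (segreRingHom e a' b' α β)) := by
    rw [← cancel_mono (chartι k (e (a', b'))), chartLift_chartι, Category.assoc]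
    exact hWr
  -- compute the ratio: `z_{(a,b)}/z_{(a',b')} ↦ (x_a/x_{a'}) (y_b/y_{b'})`
  have key : pull (chartLift r (e (a', b'))) (frac k (e (a', b')) (e (a, b))) = pull α (frac k a' a) * pull β (frac k b' b) := by
    rw [hlift, pull_SpecMap, ← segreFun_X_apply e a' b' α β, ← segreRingHom_frac]
    exact pull_toSpecΓ _ _
  have e1 : W.topIso.hom (pull α (frac k a' a)) = rs h₁ (homRatio r₁ a' a) := by rw [homRatio, rs_topIso_hom, hα, pull_comp]; rfl
  have e2 : W.topIso.hom (pull β (frac k b' b)) = rs h₂ (homRatio r₂ b' b) := by rw [homRatio, rs_topIso_hom, hβ, pull_comp]; rfl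
  rw [← e1, ← e2, ← map_mul, ← key]
  rfl

end Scheme

section Points

variable {k : Type} [Field k] {T : SchemeOver k} {L : Type} [Field L] [Algebra k L] {K₁ K₂ : ℕ}
  (Φ₁ : T ⟶ projectiveSpace K₁ k) (Φ₂ : T ⟶ projectiveSpace K₂ k)

/-- The charts of `Σ = (Φ₁, Φ₂) ≫ σ`: `Σ⁻¹D₊(z_{(a,b)}) = Φ₁⁻¹D₊(x_a) ∩ Φ₂⁻¹D₊(y_b)`. [cite: Hartshorne1977, II Ex. 5.11] -/
theorem affineChartData_lift_segreEmbedding_U (a : Fin (K₁ + 1)) (b : Fin (K₂ + 1)) :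
    (affineChartData (CartesianMonoidalCategory.lift Φ₁ Φ₂ ≫ segreEmbedding K₁ K₂ k)).U (segreIndexEquiv K₁ K₂ (a, b)) =
      (affineChartData Φ₁).U a ⊓ (affineChartData Φ₂).U b :=
  have H : Φ₁.left ≫ toSpec (Fin (K₁ + 1)) k = Φ₂.left ≫ toSpec (Fin (K₂ + 1)) k := (Over.w Φ₁).trans (Over.w Φ₂).symm
  preU_lift_segre (segreIndexEquiv K₁ K₂) a b Φ₁.left Φ₂.left H

/-- **The values of the ratios of `Σ = (Φ₁, Φ₂) ≫ σ` at `L`-points are products**: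
`Σ^*(z_{(a,b)}/z_{(a',b')})(Q) = Φ₁^*(x_a/x_{a'})(Q) · Φ₂^*(y_b/y_{b'})(Q)` (total evaluations: both sides vanish off
the chart `Σ⁻¹D₊(z_{(a',b')}) = Φ₁⁻¹D₊(x_{a'}) ∩ Φ₂⁻¹D₊(y_{b'})`). [cite: Hartshorne1977, II Ex. 5.11 and II Thm. 7.1] -/
theorem evalOrZero_ratio_lift_segreEmbedding (a a' : Fin (K₁ + 1)) (b b' : Fin (K₂ + 1)) (Q : AlgPoints T L) :
    AlgPoints.evalOrZero
        ((affineChartData (CartesianMonoidalCategory.lift Φ₁ Φ₂ ≫ segreEmbedding K₁ K₂ k)).U (segreIndexEquiv K₁ K₂ (a', b')))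
        ((affineChartData (CartesianMonoidalCategory.lift Φ₁ Φ₂ ≫ segreEmbedding K₁ K₂ k)).ratio
          (segreIndexEquiv K₁ K₂ (a', b')) (segreIndexEquiv K₁ K₂ (a, b))) Q =
      AlgPoints.evalOrZero ((affineChartData Φ₁).U a') ((affineChartData Φ₁).ratio a' a) Q *
        AlgPoints.evalOrZero ((affineChartData Φ₂).U b') ((affineChartData Φ₂).ratio b' b) Q := by
  have hU := affineChartData_lift_segreEmbedding_U Φ₁ Φ₂ a' b'
  have h₁ := hU.le.trans inf_le_left
  have h₂ := hU.le.trans inf_le_right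
  -- the ratio is the product of the restricted ratios (Part A for `k`-schemes)
  have hratio : (affineChartData (CartesianMonoidalCategory.lift Φ₁ Φ₂ ≫ segreEmbedding K₁ K₂ k)).ratio
      (segreIndexEquiv K₁ K₂ (a', b')) (segreIndexEquiv K₁ K₂ (a, b)) =
      T.left.presheaf.map (homOfLE h₁).op ((affineChartData Φ₁).ratio a' a) *
        T.left.presheaf.map (homOfLE h₂).op ((affineChartData Φ₂).ratio b' b) :=
    have H : Φ₁.left ≫ toSpec (Fin (K₁ + 1)) k = Φ₂.left ≫ toSpec (Fin (K₂ + 1)) k := (Over.w Φ₁).trans (Over.w Φ₂).symm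
    homRatio_lift_segre (segreIndexEquiv K₁ K₂) a a' b b' Φ₁.left Φ₂.left H h₁ h₂
  by_cases hQ : Q.pt ∈ (affineChartData (CartesianMonoidalCategory.lift Φ₁ Φ₂ ≫ segreEmbedding K₁ K₂ k)).U
      (segreIndexEquiv K₁ K₂ (a', b'))
  · rw [AlgPoints.evalOrZero_of_mem _ hQ, AlgPoints.evalOrZero_of_mem _ (h₁ hQ), AlgPoints.evalOrZero_of_mem _ (h₂ hQ),
      hratio, ← AlgPoints.evalRingHom_apply, map_mul, AlgPoints.evalRingHom_apply, AlgPoints.evalRingHom_apply,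
      AlgPoints.eval_map_homOfLE h₁ _ hQ, AlgPoints.eval_map_homOfLE h₂ _ hQ]
  · rw [AlgPoints.evalOrZero_of_not_mem _ hQ]
    rw [hU] at hQ
    rcases not_and_or.1 hQ with h | h
    · rw [AlgPoints.evalOrZero_of_not_mem _ h, zero_mul]
    · rw [AlgPoints.evalOrZero_of_not_mem _ h, mul_zero]

end Points

section Coordinates

variable {k : Type} [Field k] [Algebra k ℂ] {T : SchemeOver k} {M : Type*} {K₁ K₂ : ℕ}
  (Φ₁ : T ⟶ projectiveSpace K₁ k) (Φ₂ : T ⟶ projectiveSpace K₂ k) (φ : M → ComplexPoints T)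

/-- **The chart domains of `Σ = (Φ₁, Φ₂) ≫ σ` on `M` are the intersections** `M_{(a,b)} = M¹_a ∩ M²_b` of the
chart domains of `Φ₁` and `Φ₂`, for any `φ : M → T(ℂ)`. [cite: Hartshorne1977, II Ex. 5.11] -/
theorem chartDom_lift_segreEmbedding (t : Fin (K₁ * K₂ + K₁ + K₂ + 1)) :
    chartDom (CartesianMonoidalCategory.lift Φ₁ Φ₂ ≫ segreEmbedding K₁ K₂ k) φ t =
      chartDom Φ₁ φ ((segreIndexEquiv K₁ K₂).symm t).1 ∩ chartDom Φ₂ φ ((segreIndexEquiv K₁ K₂).symm t).2 := by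
  obtain ⟨⟨a, b⟩, rfl⟩ := (segreIndexEquiv K₁ K₂).surjective t
  ext m
  simp only [Equiv.symm_apply_apply, Set.mem_inter_iff]
  change (φ m).pt ∈ (affineChartData (CartesianMonoidalCategory.lift Φ₁ Φ₂ ≫ segreEmbedding K₁ K₂ k)).U
      (segreIndexEquiv K₁ K₂ (a, b)) ↔ (φ m).pt ∈ (affineChartData Φ₁).U a ∧ (φ m).pt ∈ (affineChartData Φ₂).U b
  rw [affineChartData_lift_segreEmbedding_U]
  rfl

/-- **The affine coordinates of `Σ = (Φ₁, Φ₂) ≫ σ` are the products of those of `Φ₁` and `Φ₂`**: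
`Σ^*(z_{(a,b)}/z_{(a',b')}) ∘ φ = (Φ₁^*(x_a/x_{a'}) ∘ φ) · (Φ₂^*(y_b/y_{b'}) ∘ φ)` everywhere on `M` (both sides
vanish off `M_{(a',b')}`) — the transition functions of `𝒪_Σ(-1)` are the products of those of `𝒪_{Φ₁}(-1)` and
`𝒪_{Φ₂}(-1)`: the tautological cocycle of `Σ` is the tensor product cocycle (`σ^*𝒪(1) = 𝒪(1, 1)`).
[cite: Hartshorne1977, II Ex. 5.12] -/
theorem coordFun_lift_segreEmbedding (t s : Fin (K₁ * K₂ + K₁ + K₂ + 1)) (m : M) :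
    coordFun (CartesianMonoidalCategory.lift Φ₁ Φ₂ ≫ segreEmbedding K₁ K₂ k) φ t m s =
      coordFun Φ₁ φ ((segreIndexEquiv K₁ K₂).symm t).1 m ((segreIndexEquiv K₁ K₂).symm s).1 *
        coordFun Φ₂ φ ((segreIndexEquiv K₁ K₂).symm t).2 m ((segreIndexEquiv K₁ K₂).symm s).2 := by
  obtain ⟨⟨a', b'⟩, rfl⟩ := (segreIndexEquiv K₁ K₂).surjective t
  obtain ⟨⟨a, b⟩, rfl⟩ := (segreIndexEquiv K₁ K₂).surjective s
  simp only [Equiv.symm_apply_apply]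
  exact evalOrZero_ratio_lift_segreEmbedding Φ₁ Φ₂ a a' b b' (φ m)

end Coordinates

/-! ## Part B. The product connection on `𝒪_Σ(-1)` and `ch₁(𝒪_Σ(-1)) = ch₁(𝒪_{Φ₁}(-1)) + ch₁(𝒪_{Φ₂}(-1))` -/

/-- For `1 × 1` matrices of `2`-forms, the first wedge power `Ω¹ = 1 ∧ Ω` at a point is additive in the entry
at that point (bilinearity of `∧`). [folklore] -/
theorem npow_one_apply_eq_add {E : Type*} [NormedAddCommGroup E] [NormedSpace ℂ E] {M : Type*} [TopologicalSpace M]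
    [ChartedSpace E M] {Ω Ω₁ Ω₂ : MatrixForm 𝓘(ℝ, E) M 1 2} {m : M} (h : Ω 0 0 m = Ω₁ 0 0 m + Ω₂ 0 0 m) :
    MatrixForm.npow Ω 1 0 0 m = MatrixForm.npow Ω₁ 1 0 0 m + MatrixForm.npow Ω₂ 1 0 0 m := by
  simp only [MatrixForm.npow_succ, MatrixForm.npow_zero, MatrixForm.castDeg_apply, MatrixForm.wedge_apply, Fin.sum_univ_one]
  ext v
  simp only [MForm.castDeg_apply, ContinuousAlternatingMap.add_apply, MForm.wedge_apply, h]
  exact congrFun (congrArg DFunLike.coe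
    (ContinuousAlternatingMap.wedge_add_right (V := E) (MatrixForm.one 0 0 m) (Ω₁ 0 0 m) (Ω₂ 0 0 m))) _

section Connection

variable {k : Type} [Field k] [Algebra k ℂ] {T : SchemeOver k}
  {M : Type*} {E : Type*} [NormedAddCommGroup E] [NormedSpace ℂ E] [FiniteDimensional ℂ E]
  [TopologicalSpace M] [ChartedSpace E M] {K₁ K₂ : ℕ} (Φ₁ : T ⟶ projectiveSpace K₁ k) (Φ₂ : T ⟶ projectiveSpace K₂ k)
  [IsClosedImmersion Φ₁.left] [IsClosedImmersion Φ₂.left]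
  [IsClosedImmersion (CartesianMonoidalCategory.lift Φ₁ Φ₂ ≫ segreEmbedding K₁ K₂ k).left]
  {φ : M → ComplexPoints T} {d : ℕ} (hφ : IsAnalytification E T d φ) [IsManifold 𝓘(ℂ, E) ω M] [IsManifold 𝓘(ℝ, E) ∞ M]

/-- **The gauge law for the product connection on `𝒪_Σ(-1)`.** On the tautological cocycle of
`Σ = (Φ₁, Φ₂) ≫ σ` (transition functions `g_{st} = g¹_{aa'} g²_{bb'}`, `s = (a,b)`, `t = (a',b')`), the `1 × 1`
matrices of `1`-forms `ω_t = ω¹_{a'} + ω²_{b'}` — sums of the Fubini–Study connection forms `ωⁱ_j = Gⁱ_j^*∂ log ‖Z‖²`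
of `𝒪_{Φᵢ}(-1)` (`tautologicalConnection`) — satisfy Kobayashi's gauge law (1.16) `ω_t = g_ts ω_s g_st + g_ts dg_st`:
the logarithmic derivative of a product of transition functions is the sum of the logarithmic derivatives, and
each `ωⁱ` satisfies its own gauge law (`fsConnectionPullback_smul_apply`). [cite: Kobayashi1987, Ch. I §1 (1.16)] -/
theorem segre_form_eq (s t : Fin (K₁ * K₂ + K₁ + K₂ + 1)) (m : M)
    (hm : m ∈ (tautologicalBundle (CartesianMonoidalCategory.lift Φ₁ Φ₂ ≫ segreEmbedding K₁ K₂ k) hφ).baseSet s ∩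
      (tautologicalBundle (CartesianMonoidalCategory.lift Φ₁ Φ₂ ≫ segreEmbedding K₁ K₂ k) hφ).baseSet t) (i j : Fin 1) :
    (Matrix.of fun (_ _ : Fin 1) ↦ fsConnectionPullback E (coordVec Φ₁ φ ((segreIndexEquiv K₁ K₂).symm t).1) +
        fsConnectionPullback E (coordVec Φ₂ φ ((segreIndexEquiv K₁ K₂).symm t).2)) i j m =
      (MatrixForm.mulLeft
          ((tautologicalBundle (CartesianMonoidalCategory.lift Φ₁ Φ₂ ≫ segreEmbedding K₁ K₂ k) hφ).coordChange t s)
          (Matrix.of fun (_ _ : Fin 1) ↦ fsConnectionPullback E (coordVec Φ₁ φ ((segreIndexEquiv K₁ K₂).symm s).1) +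
            fsConnectionPullback E (coordVec Φ₂ φ ((segreIndexEquiv K₁ K₂).symm s).2))).mulRight
          ((tautologicalBundle (CartesianMonoidalCategory.lift Φ₁ Φ₂ ≫ segreEmbedding K₁ K₂ k) hφ).coordChange s t) i j m +
        MatrixForm.mulLeft
          ((tautologicalBundle (CartesianMonoidalCategory.lift Φ₁ Φ₂ ≫ segreEmbedding K₁ K₂ k) hφ).coordChange t s)
          (MatrixForm.ofFun (I := 𝓘(ℝ, E))
            ((tautologicalBundle (CartesianMonoidalCategory.lift Φ₁ Φ₂ ≫ segreEmbedding K₁ K₂ k) hφ).coordChange s t)).d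
          i j m := by
  obtain ⟨hs, ht⟩ := hm
  rw [tautologicalBundle_baseSet] at hs ht
  have hF : ∀ x, coordFun (CartesianMonoidalCategory.lift Φ₁ Φ₂ ≫ segreEmbedding K₁ K₂ k) φ t x s = _ :=
    fun x ↦ coordFun_lift_segreEmbedding Φ₁ Φ₂ φ t s x
  have hF' := coordFun_lift_segreEmbedding Φ₁ Φ₂ φ s t m
  have hFR : MDifferentiableAt 𝓘(ℝ, E) 𝓘(ℝ, ℂ)
      (fun y ↦ coordFun (CartesianMonoidalCategory.lift Φ₁ Φ₂ ≫ segreEmbedding K₁ K₂ k) φ t y s) m :=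
    (contMDiffAt_coordFun hφ ht s).mdifferentiableAt (by simp)
  have hs' := hs
  have ht' := ht
  rw [chartDom_lift_segreEmbedding] at hs' ht'
  obtain ⟨⟨a', b'⟩, rfl⟩ := (segreIndexEquiv K₁ K₂).surjective t
  obtain ⟨⟨a, b⟩, rfl⟩ := (segreIndexEquiv K₁ K₂).surjective s
  simp only [Equiv.symm_apply_apply] at hs' ht' hF hF' ⊢
  obtain ⟨hs₁, hs₂⟩ := hs'
  obtain ⟨ht₁, ht₂⟩ := ht'
  have hne₁ : coordFun Φ₁ φ a' m a ≠ 0 := (coordFun_ne_zero_iff ht₁).2 hs₁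
  have hne₂ : coordFun Φ₂ φ b' m b ≠ 0 := (coordFun_ne_zero_iff ht₂).2 hs₂
  have hf₁ : MDifferentiableAt 𝓘(ℂ, E) 𝓘(ℂ, ℂ) (fun y ↦ coordFun Φ₁ φ a' y a) m := mdifferentiableAt_coordFun hφ ht₁ a
  have hf₂ : MDifferentiableAt 𝓘(ℂ, E) 𝓘(ℂ, ℂ) (fun y ↦ coordFun Φ₂ φ b' y b) m := mdifferentiableAt_coordFun hφ ht₂ b
  have hf12 : MDifferentiableAt 𝓘(ℂ, E) 𝓘(ℂ, ℂ) (fun y ↦ coordFun Φ₁ φ a' y a * coordFun Φ₂ φ b' y b) m :=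
    hf₁.mul hf₂
  -- Leibniz: `d(g¹ g²) = g¹ dg² + g² dg¹`
  have hdF : ∀ v : TangentSpace 𝓘(ℝ, E) m,
      mvfderiv 𝓘(ℝ, E) (fun y ↦ coordFun (CartesianMonoidalCategory.lift Φ₁ Φ₂ ≫ segreEmbedding K₁ K₂ k) φ
          (segreIndexEquiv K₁ K₂ (a', b')) y (segreIndexEquiv K₁ K₂ (a, b))) m v =
        coordFun Φ₁ φ a' m a * mvfderiv 𝓘(ℝ, E) (fun y ↦ coordFun Φ₂ φ b' y b) m v +
          coordFun Φ₂ φ b' m b * mvfderiv 𝓘(ℝ, E) (fun y ↦ coordFun Φ₁ φ a' y a) m v := by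
    intro v
    rw [show (fun y ↦ coordFun (CartesianMonoidalCategory.lift Φ₁ Φ₂ ≫ segreEmbedding K₁ K₂ k) φ
        (segreIndexEquiv K₁ K₂ (a', b')) y (segreIndexEquiv K₁ K₂ (a, b))) =
        fun y ↦ coordFun Φ₁ φ a' y a * coordFun Φ₂ φ b' y b from funext hF,
      mvfderiv_real_apply_eq_complex hf12, mvfderiv_fun_mul hf₁ hf₂, _root_.add_apply, _root_.smul_apply,
      _root_.smul_apply, ← mvfderiv_real_apply_eq_complex hf₁, ← mvfderiv_real_apply_eq_complex hf₂,
      smul_eq_mul, smul_eq_mul]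
  ext v
  simp only [Matrix.of_apply, MatrixForm.mulRight_apply, MatrixForm.mulLeft_apply, Fin.sum_univ_one,
    MatrixForm.d_apply, MatrixForm.ofFun_apply, tautologicalBundle_coordChange_apply, Pi.add_apply,
    ContinuousAlternatingMap.add_apply, ContinuousAlternatingMap.smul_apply, smul_eq_mul]
  rw [eq_vecCons_one v, fsConnectionPullback_congr_of_eventuallyEq (coordVec_eventuallyEq_smul hφ hs₁ ht₁),
    fsConnectionPullback_congr_of_eventuallyEq (coordVec_eventuallyEq_smul hφ hs₂ ht₂),
    fsConnectionPullback_smul_apply hf₁ (mdifferentiableAt_coordVec hφ hs₁) hne₁ (coordVec_ne_zero hs₁),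
    fsConnectionPullback_smul_apply hf₂ (mdifferentiableAt_coordVec hφ hs₂) hne₂ (coordVec_ne_zero hs₂),
    mextDeriv_ofFun_apply_eq_mvfderiv hFR, Matrix.cons_val_zero, hdF, hF m, hF',
    coordFun_symm_eq_inv ht₁ hs₁, coordFun_symm_eq_inv ht₂ hs₂]
  field_simp
  ring

/-- **`ch₁` of the product connection is the sum.** For any connection `D` on `𝒪_Σ(-1)` with forms
`ω_t = ω¹_{a'} + ω²_{b'}`, on the chart `M_t` the curvature is `Ω_t = Ω¹_{a'} + Ω²_{b'}` (`Ω = dω + ω ∧ ω` with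
`ω ∧ ω = 0` in rank one, `d` additive at points where both forms are smooth; Kobayashi I (1.12)), hence
`ch₁(𝒪_Σ(-1), D)|_{M_t} = ch₁(𝒪_{Φ₁}(-1), D¹)|_{M¹_{a'}} + ch₁(𝒪_{Φ₂}(-1), D²)|_{M²_{b'}}` (`ch₁ = -tr Ω/2πi` is
linear in `Ω`). [cite: Kobayashi1987, Ch. II §2 (2.21)] -/
theorem chernCharacterForm_one_segre_apply
    (D : (tautologicalBundle (CartesianMonoidalCategory.lift Φ₁ Φ₂ ≫ segreEmbedding K₁ K₂ k) hφ).Connection)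
    (hD : ∀ t, D.form t 0 0 = fsConnectionPullback E (coordVec Φ₁ φ ((segreIndexEquiv K₁ K₂).symm t).1) +
      fsConnectionPullback E (coordVec Φ₂ φ ((segreIndexEquiv K₁ K₂).symm t).2))
    {t : Fin (K₁ * K₂ + K₁ + K₂ + 1)} {m : M} (hm : m ∈ chartDom (CartesianMonoidalCategory.lift Φ₁ Φ₂ ≫ segreEmbedding K₁ K₂ k) φ t) :
    D.chernCharacterForm 1 t m = (tautologicalConnection Φ₁ hφ).chernCharacterForm 1 ((segreIndexEquiv K₁ K₂).symm t).1 m +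
      (tautologicalConnection Φ₂ hφ).chernCharacterForm 1 ((segreIndexEquiv K₁ K₂).symm t).2 m := by
  rw [chartDom_lift_segreEmbedding] at hm
  -- the curvatures add
  have hΩ : D.curvature t 0 0 m = (tautologicalConnection Φ₁ hφ).curvature ((segreIndexEquiv K₁ K₂).symm t).1 0 0 m +
      (tautologicalConnection Φ₂ hφ).curvature ((segreIndexEquiv K₁ K₂).symm t).2 0 0 m := by
    change mextDeriv (D.form t 0 0) m + (∑ c, (D.form t 0 c).wedge (D.form t c 0)) m =
      (mextDeriv ((tautologicalConnection Φ₁ hφ).form ((segreIndexEquiv K₁ K₂).symm t).1 0 0) m +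
        (∑ c, ((tautologicalConnection Φ₁ hφ).form ((segreIndexEquiv K₁ K₂).symm t).1 0 c).wedge
          ((tautologicalConnection Φ₁ hφ).form ((segreIndexEquiv K₁ K₂).symm t).1 c 0)) m) +
      (mextDeriv ((tautologicalConnection Φ₂ hφ).form ((segreIndexEquiv K₁ K₂).symm t).2 0 0) m +
        (∑ c, ((tautologicalConnection Φ₂ hφ).form ((segreIndexEquiv K₁ K₂).symm t).2 0 c).wedge
          ((tautologicalConnection Φ₂ hφ).form ((segreIndexEquiv K₁ K₂).symm t).2 c 0)) m)
    simp only [Fin.sum_univ_one, hD, tautologicalConnection_form_apply, wedge_self_apply_eq_zero, add_zero]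
    exact mextDeriv_add_apply
      (smoothAt_fsConnectionPullback (mdifferentiableOn_coordVec hφ _) (isOpen_chartDom hφ _) hm.1 (coordVec_ne_zero hm.1))
      (smoothAt_fsConnectionPullback (mdifferentiableOn_coordVec hφ _) (isOpen_chartDom hφ _) hm.2 (coordVec_ne_zero hm.2))
  simp only [SmoothComplexVectorBundle.Connection.chernCharacterForm, Pi.smul_apply, Matrix.trace_fin_one]
  rw [npow_one_apply_eq_add hΩ, smul_add]

end Connection

/-- **`ch₁` of `𝒪(-1)` is additive under the Segre embedding.** For `T` smooth projective over `ℂ` with a Hodge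
model `A`, closed immersions `Φ₁ : T ⟶ ℙ^{K₁}`, `Φ₂ : T ⟶ ℙ^{K₂}` and the composite closed immersion
`Σ = (Φ₁, Φ₂) ≫ σ : T ⟶ ℙ^{K₁K₂+K₁+K₂}` with the Segre embedding, the first Chern character classes of the
tautological cocycles satisfy `ch₁(𝒪_Σ(-1)) = ch₁(𝒪_{Φ₁}(-1)) + ch₁(𝒪_{Φ₂}(-1))` in `H²(T(ℂ); ℂ)`: the cocycle of
`Σ` is the tensor product of the other two (`coordFun_lift_segreEmbedding`; Hartshorne II Ex. 5.12:
`σ^*𝒪(1) = 𝒪(1,1)`), the product of the two Fubini–Study connections is a connection on it whose first Chern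
character form is the sum `-(θ₁ + θ₂)/2π` of the two global forms (`HodgeModel.isChernCharacterForm_tautologicalConnection`),
and `ch₁` is computed by any connection (`HodgeModel.pullback_chernCharacter`, Kobayashi II Thm. 2.16) with
`A.pullback` injective — Kobayashi II (1.9)–(1.10): `c₁(L ⊗ L') = c₁(L) + c₁(L')`.
[cite: Kobayashi1987, Ch. II §1 (1.9)–(1.10) and §2 Thm. 2.16] [cite: Hartshorne1977, II Ex. 5.12] -/
theorem HodgeModel.chernCharacter_tautologicalBundle_segre :
    ∀ ⦃n K₁ K₂ : ℕ⦄ ⦃T : Motives.SchemeOver ℂ⦄ (_hT : Motives.IsSmoothProjective n T) (A : HodgeModel n T)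
      (Φ₁ : T ⟶ Motives.projectiveSpace K₁ ℂ) [IsClosedImmersion Φ₁.left]
      (Φ₂ : T ⟶ Motives.projectiveSpace K₂ ℂ) [IsClosedImmersion Φ₂.left]
      [IsClosedImmersion (CartesianMonoidalCategory.lift Φ₁ Φ₂ ≫ Motives.segreEmbedding K₁ K₂ ℂ).left],
      A.chernCharacter (Motives.AnalytificationKaehler.tautologicalBundle
          (CartesianMonoidalCategory.lift Φ₁ Φ₂ ≫ Motives.segreEmbedding K₁ K₂ ℂ) A.isAnalytification) 1 =
        A.chernCharacter (Motives.AnalytificationKaehler.tautologicalBundle Φ₁ A.isAnalytification) 1 +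
          A.chernCharacter (Motives.AnalytificationKaehler.tautologicalBundle Φ₂ A.isAnalytification) 1 := by
  intro n K₁ K₂ T hT A Φ₁ _ Φ₂ _ _
  obtain ⟨g₁, hg₁K, hg₁⟩ := A.exists_isKaehler_kaehlerForm_eq_fubiniStudyPullbackForm hT Φ₁
  obtain ⟨g₂, hg₂K, hg₂⟩ := A.exists_isKaehler_kaehlerForm_eq_fubiniStudyPullbackForm hT Φ₂
  have hs₁ := A.isSmoothForm_smul_kaehlerFormPow_ofReal g₁ (((1 : ℕ).factorial : ℂ)⁻¹ * (-(2 * (Real.pi : ℂ))⁻¹) ^ 1) 1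
  have hc₁ := A.isClosedForm_smul_kaehlerFormPow_ofReal g₁ hg₁K (((1 : ℕ).factorial : ℂ)⁻¹ * (-(2 * (Real.pi : ℂ))⁻¹) ^ 1) 1
  have hs₂ := A.isSmoothForm_smul_kaehlerFormPow_ofReal g₂ (((1 : ℕ).factorial : ℂ)⁻¹ * (-(2 * (Real.pi : ℂ))⁻¹) ^ 1) 1
  have hc₂ := A.isClosedForm_smul_kaehlerFormPow_ofReal g₂ hg₂K (((1 : ℕ).factorial : ℂ)⁻¹ * (-(2 * (Real.pi : ℂ))⁻¹) ^ 1) 1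
  have hθ₁ := A.isChernCharacterForm_tautologicalConnection Φ₁ g₁ hg₁ 1
  have hθ₂ := A.isChernCharacterForm_tautologicalConnection Φ₂ g₂ hg₂ 1
  -- the product (tensor) connection on `𝒪_Σ(-1)`: forms `ω_t = ω¹_{a'} + ω²_{b'}` (a structure VALUE, no definition)
  let D : (tautologicalBundle (CartesianMonoidalCategory.lift Φ₁ Φ₂ ≫ Motives.segreEmbedding K₁ K₂ ℂ) A.isAnalytification).Connection :=
    { form := fun t ↦ Matrix.of fun _ _ ↦
        fsConnectionPullback A.model (coordVec Φ₁ A.toComplexPoints ((Motives.segreIndexEquiv K₁ K₂).symm t).1) +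
          fsConnectionPullback A.model (coordVec Φ₂ A.toComplexPoints ((Motives.segreIndexEquiv K₁ K₂).symm t).2)
      isSmoothFormOn_form := fun t _ _ m hm ↦ by
        have hm' := hm
        rw [tautologicalBundle_baseSet, chartDom_lift_segreEmbedding] at hm'
        exact (smoothAt_fsConnectionPullback (mdifferentiableOn_coordVec A.isAnalytification _)
          (isOpen_chartDom A.isAnalytification _) hm'.1 (coordVec_ne_zero hm'.1)).add
          (smoothAt_fsConnectionPullback (mdifferentiableOn_coordVec A.isAnalytification _)
            (isOpen_chartDom A.isAnalytification _) hm'.2 (coordVec_ne_zero hm'.2))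
      form_eq := fun s t m hm a b ↦ segre_form_eq Φ₁ Φ₂ A.isAnalytification s t m hm a b }
  have hD : ∀ t, D.form t 0 0 = fsConnectionPullback A.model (coordVec Φ₁ A.toComplexPoints ((Motives.segreIndexEquiv K₁ K₂).symm t).1) +
      fsConnectionPullback A.model (coordVec Φ₂ A.toComplexPoints ((Motives.segreIndexEquiv K₁ K₂).symm t).2) :=
    fun _ ↦ rfl
  -- its first Chern character form is the sum of the two global forms `-(θᵢ/2π)`, smooth and closed
  have hθ : D.IsChernCharacterForm 1
      ((((1 : ℕ).factorial : ℂ)⁻¹ * (-(2 * (Real.pi : ℂ))⁻¹) ^ 1) • (Motives.kaehlerFormPow g₁.toRiemannianMetric 1).ofReal +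
        (((1 : ℕ).factorial : ℂ)⁻¹ * (-(2 * (Real.pi : ℂ))⁻¹) ^ 1) • (Motives.kaehlerFormPow g₂.toRiemannianMetric 1).ofReal) := by
    intro t m hm
    have hm' := hm
    rw [tautologicalBundle_baseSet, chartDom_lift_segreEmbedding] at hm'
    rw [Pi.add_apply, hθ₁ _ m hm'.1, hθ₂ _ m hm'.2, chernCharacterForm_one_segre_apply Φ₁ Φ₂ A.isAnalytification D hD hm]
  have hcl : IsClosedForm
      ((((1 : ℕ).factorial : ℂ)⁻¹ * (-(2 * (Real.pi : ℂ))⁻¹) ^ 1) • (Motives.kaehlerFormPow g₁.toRiemannianMetric 1).ofReal +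
        (((1 : ℕ).factorial : ℂ)⁻¹ * (-(2 * (Real.pi : ℂ))⁻¹) ^ 1) • (Motives.kaehlerFormPow g₂.toRiemannianMetric 1).ofReal) := by
    rw [IsClosedForm, mextDeriv_add hs₁ hs₂, hc₁, hc₂, add_zero]
  -- Chern–Weil: every connection computes `ch₁`; compare on the model and pull back injectively
  have h := A.pullback_chernCharacter _ 1 D (hs₁.add hs₂) hcl hθ
  have h₁ := A.pullback_chernCharacter _ 1 (tautologicalConnection Φ₁ A.isAnalytification) hs₁ hc₁ hθ₁
  have h₂ := A.pullback_chernCharacter _ 1 (tautologicalConnection Φ₂ A.isAnalytification) hs₂ hc₂ hθ₂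
  apply A.pullback_injective (2 * 1)
  rw [map_add, h, h₁, h₂, ← map_add, ← map_add]
  rfl

end Literature.AlgebraicGeometry.HodgeTheory

end
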